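import Mathlib
import Summits.NavierStokesRegularity.NavierStokesRegularity.Theorems.FilamentSkeletonRssClause13ModelPieceBandPrelim
import Summits.NavierStokesRegularity.NavierStokesRegularity.Theorems.FilamentSkeletonRssClause13LowSliceBottom

/-!
# Clause 13-J/13-R, brick n3 LAYER D (DECOMPOSITION): `Y = ΣP_s + Y_H` in `L²`, `N(Y)² ≤ 6Σ∫‖P_s‖²`, and the ball facts

Route `FilamentSkeletonRss`, ∃-side clause 13 (`Clause13RNearStraightL` stmt-NavierStokesRegularity-23612; typing-agnostic); design
`filament-plan/DESIGN-28296-model-gluing-g16(-v2-addendum).md` §C (task C6).  The measure-theoretic half of the gluing step, kept apart from the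
arithmetic half (`…Clause13ModelGluingAlgebra`, which this file does not import):

* §1 linearity of a piece in its kernel (`piece_add_kernel`, `piece_two_mul_kernel`) and the SIX-PIECE DECOMPOSITION `model_decomposition`:
  if the near kernel is `k_N = k_S0 + k_S1 + 2a + k_M` pointwise then
  `Y = k_S0∗Y + k_S1∗Y + (a∗Y + i·b∗Y) + (a∗Y − i·b∗Y) + k_M∗Y + (Y − k_N∗Y)` pointwise (any real `b`);
* §2 `sq_l2_le_six_sum` — Minkowski for six `L²` functions and Cauchy–Schwarz: `N(Y)² ≤ 6·Σ∫‖f_i‖²` when `Y = Σf_i`;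
* §3 ball facts for a variation vanishing off `[c−R, c+R]`: `l2_weight_le_of_support` (`N((τ−c)Y) ≤ R·N(Y)`; the `L¹` fact
  `‖Y‖₁ ≤ √(2R)N(Y)` is `integral_norm_le_sqrt_mul_of_support`, p695802);
* §4 the far piece `Y_H = Y − k∗Y` in the common atoms: `l2_far_le` (`N(Y_H) ≤ (1+‖k‖₁)N(Y)`), `l2_weight_far_le`
  (`N((τ−c)Y_H) ≤ (R + √2(‖k‖₁R + ‖t k‖₁))·N(Y)`).
`N(f) = (∫‖f‖²)^{1/2}` throughout.
Lane ns-filament-19175-p1 g17; `--supports stmt-NavierStokesRegularity-23612 --as helper`.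
HONEST FRAMING: bookkeeping about an explicit 1-D model operator attached to a HYPOTHETICAL filament skeleton on the NEGATIVE side of a MODEL route;
nothing here bears on Navier–Stokes regularity or blow-up.
-/

noncomputable section

open MeasureTheory Real Complex Filter Set
open scoped ComplexConjugate Topology

namespace Summit.NavierStokesRegularity.NavierStokesRegularity.Theorems.MatchedKernel
set_option linter.dupNamespace false

/-! ## §1 Linearity in the kernel and the six-piece decomposition -/

/-- `(k₁ + k₂)∗Y = k₁∗Y + k₂∗Y` pointwise (`k_i` continuous, `Y ∈ C_c`). [folklore] -/
theorem piece_add_kernel {k₁ k₂ : ℝ → ℝ} (hk₁ : Continuous k₁) (hk₂ : Continuous k₂) {Y : ℝ → ℂ} (hYc : Continuous Y)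
    (hYs : HasCompactSupport Y) (x : ℝ) :
    ∫ y : ℝ, (((k₁ (x - y) + k₂ (x - y) : ℝ)) : ℂ) * Y y
      = (∫ y : ℝ, ((k₁ (x - y) : ℝ) : ℂ) * Y y) + ∫ y : ℝ, ((k₂ (x - y) : ℝ) : ℂ) * Y y := by
  rw [← integral_add (integrable_piece_integrand hk₁ hYc hYs x) (integrable_piece_integrand hk₂ hYc hYs x)]
  refine integral_congr_ae (ae_of_all _ fun y => ?_)
  push_cast
  ring

/-- `(2a)∗Y = (a∗Y + i·b∗Y) + (a∗Y − i·b∗Y)` pointwise (any real `a, b`). [folklore] -/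
theorem piece_two_mul_kernel (a b : ℝ → ℝ) (Y : ℝ → ℂ) (x : ℝ) :
    ∫ y : ℝ, (((2 * a (x - y) : ℝ)) : ℂ) * Y y
      = ((∫ y : ℝ, ((a (x - y) : ℝ) : ℂ) * Y y) + I * ∫ y : ℝ, ((b (x - y) : ℝ) : ℂ) * Y y)
        + ((∫ y : ℝ, ((a (x - y) : ℝ) : ℂ) * Y y) - I * ∫ y : ℝ, ((b (x - y) : ℝ) : ℂ) * Y y) := by
  have h : ∫ y : ℝ, (((2 * a (x - y) : ℝ)) : ℂ) * Y y = 2 * ∫ y : ℝ, ((a (x - y) : ℝ) : ℂ) * Y y := by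
    rw [← integral_const_mul]
    refine integral_congr_ae (ae_of_all _ fun y => ?_)
    push_cast
    ring
  rw [h]
  ring

/-- **SIX-PIECE DECOMPOSITION.**  If `k_N = k_S0 + k_S1 + 2a + k_M` pointwise (all continuous) then for `Y ∈ C_c` and every `x`:
`Y(x) = (k_S0∗Y)(x) + (k_S1∗Y)(x) + ((a∗Y)(x) + i(b∗Y)(x)) + ((a∗Y)(x) − i(b∗Y)(x)) + (k_M∗Y)(x) + (Y(x) − (k_N∗Y)(x))`. [folklore] -/
theorem model_decomposition {kS0 kS1 a kM kN : ℝ → ℝ} (hS0 : Continuous kS0) (hS1 : Continuous kS1) (ha : Continuous a)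
    (hM : Continuous kM) (b : ℝ → ℝ) (hsum : ∀ t, kN t = kS0 t + kS1 t + 2 * a t + kM t) {Y : ℝ → ℂ} (hYc : Continuous Y)
    (hYs : HasCompactSupport Y) (x : ℝ) :
    Y x = (∫ y : ℝ, ((kS0 (x - y) : ℝ) : ℂ) * Y y) + (∫ y : ℝ, ((kS1 (x - y) : ℝ) : ℂ) * Y y)
      + ((∫ y : ℝ, ((a (x - y) : ℝ) : ℂ) * Y y) + I * ∫ y : ℝ, ((b (x - y) : ℝ) : ℂ) * Y y)
      + ((∫ y : ℝ, ((a (x - y) : ℝ) : ℂ) * Y y) - I * ∫ y : ℝ, ((b (x - y) : ℝ) : ℂ) * Y y)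
      + (∫ y : ℝ, ((kM (x - y) : ℝ) : ℂ) * Y y) + (Y x - ∫ y : ℝ, ((kN (x - y) : ℝ) : ℂ) * Y y) := by
  have hN : ∫ y : ℝ, ((kN (x - y) : ℝ) : ℂ) * Y y
      = (∫ y : ℝ, ((kS0 (x - y) : ℝ) : ℂ) * Y y) + (∫ y : ℝ, ((kS1 (x - y) : ℝ) : ℂ) * Y y)
        + (((∫ y : ℝ, ((a (x - y) : ℝ) : ℂ) * Y y) + I * ∫ y : ℝ, ((b (x - y) : ℝ) : ℂ) * Y y)
          + ((∫ y : ℝ, ((a (x - y) : ℝ) : ℂ) * Y y) - I * ∫ y : ℝ, ((b (x - y) : ℝ) : ℂ) * Y y))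
        + ∫ y : ℝ, ((kM (x - y) : ℝ) : ℂ) * Y y := by
    have e : (fun y : ℝ => ((kN (x - y) : ℝ) : ℂ) * Y y) = fun y : ℝ =>
        ((((kS0 (x - y) : ℝ) : ℂ) * Y y + ((kS1 (x - y) : ℝ) : ℂ) * Y y) + (((2 * a (x - y) : ℝ)) : ℂ) * Y y) + ((kM (x - y) : ℝ) : ℂ) * Y y := by
      funext y; rw [hsum]; push_cast; ring
    have h2a : Integrable (fun y : ℝ => (((2 * a (x - y) : ℝ)) : ℂ) * Y y) := by
      have h := (integrable_piece_integrand ha hYc hYs x).const_mul (2 : ℂ)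
      refine h.congr (ae_of_all _ fun y => ?_); push_cast; ring
    have hA := integrable_piece_integrand hS0 hYc hYs x
    have hB := integrable_piece_integrand hS1 hYc hYs x
    have hD := integrable_piece_integrand hM hYc hYs x
    have hAB : Integrable (fun y : ℝ => ((kS0 (x - y) : ℝ) : ℂ) * Y y + ((kS1 (x - y) : ℝ) : ℂ) * Y y) := hA.add hB
    have hABC : Integrable (fun y : ℝ => (((kS0 (x - y) : ℝ) : ℂ) * Y y + ((kS1 (x - y) : ℝ) : ℂ) * Y y) + (((2 * a (x - y) : ℝ)) : ℂ) * Y y) :=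
      hAB.add h2a
    rw [e, integral_add hABC hD, integral_add hAB h2a, integral_add hA hB, piece_two_mul_kernel a b Y x]
  rw [hN]
  ring

/-! ## §2 Minkowski for six pieces -/

/-- `((∫‖f‖²)^{1/2})² = ∫‖f‖²`. [folklore] -/
theorem l2_sq_eq (f : ℝ → ℂ) : ((∫ x, ‖f x‖ ^ 2) ^ (1 / 2 : ℝ)) ^ 2 = ∫ x, ‖f x‖ ^ 2 := by
  rw [← Real.sqrt_eq_rpow, Real.sq_sqrt (integral_nonneg fun x => by positivity)]

/-- **`N(Y)² ≤ 6·Σ_{i≤6}∫‖f_i‖²`** when `Y = f₁ + ⋯ + f₆` pointwise and each `f_i ∈ L²`. [folklore] -/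
theorem sq_l2_le_six_sum {Y f₁ f₂ f₃ f₄ f₅ f₆ : ℝ → ℂ} (hY : ∀ x, Y x = f₁ x + f₂ x + f₃ x + f₄ x + f₅ x + f₆ x)
    (h₁ : MemLp f₁ 2 volume) (h₂ : MemLp f₂ 2 volume) (h₃ : MemLp f₃ 2 volume) (h₄ : MemLp f₄ 2 volume) (h₅ : MemLp f₅ 2 volume)
    (h₆ : MemLp f₆ 2 volume) :
    ((∫ x, ‖Y x‖ ^ 2) ^ (1 / 2 : ℝ)) ^ 2
      ≤ 6 * ((∫ x, ‖f₁ x‖ ^ 2) + (∫ x, ‖f₂ x‖ ^ 2) + (∫ x, ‖f₃ x‖ ^ 2) + (∫ x, ‖f₄ x‖ ^ 2) + (∫ x, ‖f₅ x‖ ^ 2) + ∫ x, ‖f₆ x‖ ^ 2) := by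
  -- Minkowski, peeled from the right
  have s2 := l2_add_le h₁ h₂
  have s3 := l2_add_le (f := fun x => f₁ x + f₂ x) (g := f₃) (h₁.add h₂) h₃
  have s4 := l2_add_le (f := fun x => f₁ x + f₂ x + f₃ x) (g := f₄) ((h₁.add h₂).add h₃) h₄
  have s5 := l2_add_le (f := fun x => f₁ x + f₂ x + f₃ x + f₄ x) (g := f₅) (((h₁.add h₂).add h₃).add h₄) h₅
  have s6 := l2_add_le (f := fun x => f₁ x + f₂ x + f₃ x + f₄ x + f₅ x) (g := f₆) ((((h₁.add h₂).add h₃).add h₄).add h₅) h₆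
  have e : (fun x => ‖Y x‖ ^ 2) = fun x => ‖f₁ x + f₂ x + f₃ x + f₄ x + f₅ x + f₆ x‖ ^ 2 := by
    funext x; rw [hY]
  have eI : (∫ x, ‖Y x‖ ^ 2) = ∫ x, ‖f₁ x + f₂ x + f₃ x + f₄ x + f₅ x + f₆ x‖ ^ 2 := by
    show MeasureTheory.integral volume (fun x => ‖Y x‖ ^ 2) = _
    rw [e]
  rw [eI]
  -- the scalar inequality
  have key : ∀ nY n₁ n₂ n₃ n₄ n₅ n₆ : ℝ, 0 ≤ nY → nY ≤ n₁ + n₂ + n₃ + n₄ + n₅ + n₆ →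
      nY ^ 2 ≤ 6 * (n₁ ^ 2 + n₂ ^ 2 + n₃ ^ 2 + n₄ ^ 2 + n₅ ^ 2 + n₆ ^ 2) := by
    intro nY n₁ n₂ n₃ n₄ n₅ n₆ h0 h
    have hcs : (n₁ + n₂ + n₃ + n₄ + n₅ + n₆) ^ 2 ≤ 6 * (n₁ ^ 2 + n₂ ^ 2 + n₃ ^ 2 + n₄ ^ 2 + n₅ ^ 2 + n₆ ^ 2) := by
      nlinarith [sq_nonneg (n₁ - n₂), sq_nonneg (n₁ - n₃), sq_nonneg (n₁ - n₄), sq_nonneg (n₁ - n₅), sq_nonneg (n₁ - n₆),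
        sq_nonneg (n₂ - n₃), sq_nonneg (n₂ - n₄), sq_nonneg (n₂ - n₅), sq_nonneg (n₂ - n₆), sq_nonneg (n₃ - n₄), sq_nonneg (n₃ - n₅),
        sq_nonneg (n₃ - n₆), sq_nonneg (n₄ - n₅), sq_nonneg (n₄ - n₆), sq_nonneg (n₅ - n₆)]
    exact (pow_le_pow_left₀ h0 h 2).trans hcs
  have h := key ((∫ x, ‖f₁ x + f₂ x + f₃ x + f₄ x + f₅ x + f₆ x‖ ^ 2) ^ (1 / 2 : ℝ)) ((∫ x, ‖f₁ x‖ ^ 2) ^ (1 / 2 : ℝ))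
    ((∫ x, ‖f₂ x‖ ^ 2) ^ (1 / 2 : ℝ)) ((∫ x, ‖f₃ x‖ ^ 2) ^ (1 / 2 : ℝ)) ((∫ x, ‖f₄ x‖ ^ 2) ^ (1 / 2 : ℝ)) ((∫ x, ‖f₅ x‖ ^ 2) ^ (1 / 2 : ℝ))
    ((∫ x, ‖f₆ x‖ ^ 2) ^ (1 / 2 : ℝ)) (by positivity) (by linarith [s2, s3, s4, s5, s6])
  rw [l2_sq_eq f₁, l2_sq_eq f₂, l2_sq_eq f₃, l2_sq_eq f₄, l2_sq_eq f₅, l2_sq_eq f₆] at h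
  exact h

/-! ## §3 Ball facts -/

/-- **`N((τ−c)Y) ≤ R·N(Y)`** for `Y ∈ L²` vanishing off `[c−R, c+R]` (`R ≥ 0`). [folklore] -/
theorem l2_weight_le_of_support {Y : ℝ → ℂ} (hY2 : MemLp Y 2 volume) {c R : ℝ} (hR : 0 ≤ R)
    (hsupp : ∀ x, x ∉ Set.Icc (c - R) (c + R) → Y x = 0) :
    (∫ x : ℝ, ‖(((x - c : ℝ) : ℂ)) * Y x‖ ^ 2) ^ (1 / 2 : ℝ) ≤ R * (∫ x : ℝ, ‖Y x‖ ^ 2) ^ (1 / 2 : ℝ) := by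
  refine l2_le_of_sq_le hR ?_
  rw [← integral_const_mul]
  refine integral_mono_of_nonneg (ae_of_all _ fun x => by positivity) (((memLp_two_iff_integrable_sq_norm hY2.1).1 hY2).const_mul _)
    (ae_of_all _ fun x => ?_)
  by_cases hx : x ∈ Set.Icc (c - R) (c + R)
  · have hxc : |x - c| ≤ R := by
      rw [abs_le]; constructor <;> linarith [hx.1, hx.2]
    simp only [norm_mul, Complex.norm_real, Real.norm_eq_abs, mul_pow]
    exact mul_le_mul_of_nonneg_right (pow_le_pow_left₀ (abs_nonneg _) hxc 2) (by positivity)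
  · simp [hsupp x hx]

/-- A `C_c` variation with `tsupport Y ⊆ [c−R, c+R]` vanishes off the ball. [folklore] -/
theorem eq_zero_of_notMem_of_tsupport_subset {Y : ℝ → ℂ} {c R : ℝ} (hsupp : tsupport Y ⊆ Set.Icc (c - R) (c + R)) (x : ℝ)
    (hx : x ∉ Set.Icc (c - R) (c + R)) : Y x = 0 :=
  image_eq_zero_of_notMem_tsupport fun h => hx (hsupp h)

/-! ## §4 The far piece in the common atoms -/

/-- **`N(Y − k∗Y) ≤ (1 + ‖k‖₁)·N(Y)`**. [folklore] -/
theorem l2_far_le {k : ℝ → ℝ} (hkc : Continuous k) (hki : Integrable k) {Y : ℝ → ℂ} (hYc : Continuous Y) (hYs : HasCompactSupport Y) :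
    (∫ x : ℝ, ‖(Y x - ∫ y : ℝ, ((k (x - y) : ℝ) : ℂ) * Y y)‖ ^ 2) ^ (1 / 2 : ℝ) ≤ (1 + ∫ t, |k t|) * (∫ x : ℝ, ‖Y x‖ ^ 2) ^ (1 / 2 : ℝ) := by
  have hY2 : MemLp Y 2 volume := hYc.memLp_of_hasCompactSupport hYs
  obtain ⟨hP2, hPle⟩ := integral_sq_norm_piece_le hkc hki hYc hYs
  have hNP := l2_le_of_sq_le (integral_nonneg fun t => abs_nonneg _) hPle
  have hsub := l2_sub_le hY2 hP2
  linarith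

/-- **`N((τ−c)(Y − k∗Y)) ≤ (R + √2(‖k‖₁R + ‖t k‖₁))·N(Y)`** for `Y ∈ C_c` vanishing off `[c−R, c+R]`. [folklore] -/
theorem l2_weight_far_le {k : ℝ → ℝ} (hkc : Continuous k) (hki : Integrable k) (hk1 : Integrable fun t => t * k t)
    {Y : ℝ → ℂ} (hYc : Continuous Y) (hYs : HasCompactSupport Y) {c R : ℝ} (hR : 0 ≤ R)
    (hsupp : ∀ x, x ∉ Set.Icc (c - R) (c + R) → Y x = 0) :
    (∫ x : ℝ, ‖(((x - c : ℝ) : ℂ)) * (Y x - ∫ y : ℝ, ((k (x - y) : ℝ) : ℂ) * Y y)‖ ^ 2) ^ (1 / 2 : ℝ)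
      ≤ (R + Real.sqrt 2 * ((∫ t, |k t|) * R + ∫ t, |t| * |k t|)) * (∫ x : ℝ, ‖Y x‖ ^ 2) ^ (1 / 2 : ℝ) := by
  have hY2 : MemLp Y 2 volume := hYc.memLp_of_hasCompactSupport hYs
  have hwY2 : MemLp (fun x : ℝ => (((x - c : ℝ) : ℂ)) * Y x) 2 volume :=
    ((Complex.continuous_ofReal.comp (continuous_id.sub continuous_const)).mul hYc).memLp_of_hasCompactSupport hYs.mul_left
  have hwP2 := memLp_weight_piece hkc hki hk1 hYc hYs c
  have hsub := l2_sub_le hwY2 hwP2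
  have e : (∫ x : ℝ, ‖(((x - c : ℝ) : ℂ)) * (Y x - ∫ y : ℝ, ((k (x - y) : ℝ) : ℂ) * Y y)‖ ^ 2)
      = ∫ x : ℝ, ‖(((x - c : ℝ) : ℂ)) * Y x - (((x - c : ℝ) : ℂ)) * ∫ y : ℝ, ((k (x - y) : ℝ) : ℂ) * Y y‖ ^ 2 := by
    refine integral_congr_ae (ae_of_all _ fun x => ?_); simp only [mul_sub]
  rw [e]
  have hW := l2_weight_le_of_support hY2 hR hsupp
  have hWP := l2_weight_piece_le hkc hki hk1 hYc hYs c
  have hK0 : 0 ≤ ∫ t, |k t| := integral_nonneg fun t => abs_nonneg _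
  have hKW : (∫ t, |k t|) * (∫ x : ℝ, ‖(((x - c : ℝ) : ℂ)) * Y x‖ ^ 2) ^ (1 / 2 : ℝ) ≤ (∫ t, |k t|) * (R * (∫ x : ℝ, ‖Y x‖ ^ 2) ^ (1 / 2 : ℝ)) :=
    mul_le_mul_of_nonneg_left hW hK0
  nlinarith [Real.sqrt_nonneg 2, hsub, hWP, hKW]

end Summit.NavierStokesRegularity.NavierStokesRegularity.Theorems.MatchedKernel

end
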